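import Literature.Analysis.Asymptotics.LaplaceMethodOrbitCompact
import HarnessLib

/-!
# The orbit constant of Laplace's method on a critical orbit, in closed form
(`(∫_{ball ρ} J(z,0) dκ) ∕ ν(((e(ball ρ))·S)⁻¹) = J(0,0) ∕ (|S| · h(0))`, `h` the Haar density in the group chart)

Topic `Literature/Analysis/Asymptotics`; namespace `Literature.Analysis.Asymptotics`.  Sequel of
`LaplaceMethodOrbitCompact.lean` (★★★ `tendsto_laplaceMethod_orbit_indicator_of_continuous`,
`tendsto_laplaceMethod_sum_orbits_of_continuous`).  Everything here is PROVED; no definitions, no named facts.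

THE QUESTION.  The one-orbit limit of `LaplaceMethodOrbit.lean` reads
`(2π)^{m/2} · ν(K) · C(Φ) · φ(σ 0) ∕ √det A` with the ORBIT CONSTANT `C(Φ) = (∫_Φ J(z, 0) dκ) ∕ ν(((eΦ)·S)⁻¹)`,
a quotient of a window integral of the chart density by the Haar measure of a group window — both depending on
the auxiliary group window `Φ = ball 0 ρ`, neither in closed form.  A consumer computing a RATIO of two such limits
for different boxes (cell `ym-ir`, row 43: the twisted-slab defect limit is `c_{2t} ∕ c_t²`) needs every constant
as a product of explicit factors.

THE ANSWER (PROVED).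
* §1 `tendsto_setIntegral_div_measureReal_ball` — averages over shrinking balls at a continuity point converge to
  the value (elementary; `κ` locally finite and positive on open sets).
* §2 `eventually_windowConst_eq_card_mul_setIntegral` — for a finite `S ⊆ K` (`K` a Hausdorff topological group,
  `ν` right- and inversion-invariant — a compact group with a Haar measure), a continuous `e : Z → K` with
  `e 0 = 1`, injective on an open `U ∋ 0` carrying a HAAR CHART `ν|_{e(U)} = e_*((h · κ)|_U)` with `h ≥ 0` continuous
  on `U`: for all small `ρ > 0`, `ν(((e(ball ρ))·S)⁻¹) = |S| · ∫_{ball ρ} h dκ` (the translates `e(ball ρ)·s`,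
  `s ∈ S`, are pairwise disjoint for small `ρ` — `exists_nhds_one_pairwiseDisjoint_mul_singleton` — and each has
  measure `ν(e(ball ρ))` by right invariance).
* §3 ★ `tendsto_windowConst_ratio` — hence `C(ball ρ) = ⨍_{ball ρ} J(·,0) ∕ (|S| ⨍_{ball ρ} h) ⟶ J(0,0) ∕ (|S| h(0))`
  as `ρ → 0⁺`, for `J(·, 0)` continuous at `0`.
* §4 ★★ `windowConst_ratio_eq_of_continuous` — in the structural setting of
  `tendsto_laplaceMethod_orbit_indicator_of_continuous`, `C(ball ρ)` does NOT depend on the admissible `ρ` (two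
  admissible radii give two limits of the SAME Laplace sequence with amplitude `1`, and limits are unique), so
  `C(ball ρ) = J(0,0) ∕ (|S| · h(0))` for EVERY admissible `ρ`.
* §5 ★★★ the closed-form editions: `tendsto_laplaceMethod_orbit_indicator_closedForm`
  (`… ⟶ (2π)^{m/2} ν(K) J(0,0) φ(σ 0) ∕ (|S| h(0) √det A)`), `tendsto_laplaceMethod_sum_orbits_closedForm`
  (`Σ_i (2π)^{m/2} ν(K) J_i(0,0) φ(σ_i 0) ∕ (|S_i| h(0) √det A_i)`), and ★★★
  `tendsto_gibbs_expectation_sum_orbits_closedForm`: the `β → ∞` state is the probability measure on the finitely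
  many vacua with WEIGHTS `w_i = J_i(0,0) ∕ (|S_i| √det A_i)` —
  `∫ e^{−βf} φ dμ ∕ ∫ e^{−βf} dμ ⟶ (Σ_i w_i φ(σ_i 0)) ∕ Σ_i w_i`.

CONSUMER RECIPE (cell `ym-ir`, row 43): `h` := the Haar density of the gauge group `𝒢 = (sites → SU(N))` in the
exponential chart `e = expGauge ∘ T_M`, i.e. `L10`'s `haar_restrict_window_eq_map_withDensity_frame` for
`isChartRep_pi sites isChartRep_specialUnitaryGroup` (format `ν|_{e(U)} = e_*((h·vol)|_U)` with
`U = frame⁻¹(ball)`, `h = σ₀(𝒢) · |det jac ∘ frame|`, `h(0) = σ₀(𝒢)`; injectivity `injOn_translate_expChart_frame`);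
`J(0,0)` := K17 `sliceChartDensity_zero` (`= σ₀(SU(N)^E)` for the IFT frame); `|S| = N` (central constants); so the
per-orbit weight is `σ₀(SU(N)^E) ∕ (N · σ₀(𝒢) · √det A)` and in the RATIO of two boxes only the Gaussian
determinants and the explicit window constants of B89 `HaarDensitySpecialUnitaryExplicit` remain.

HONEST SCOPE.  Measure theory ∕ asymptotics at one box; nothing uniform in auxiliary parameters; nothing here bears
on the Yang–Mills mass gap (Clay), which is NOT proved; in cell `ym-ir` the rung served (`R4`) closes only the
conditional finite-`𝕋⁴` statement `BalabanLadder.UV`.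

## References
* S. Helgason, *Groups and Geometric Analysis* (2000), Ch. I §1 Thm 1.14 (12)–(13) p. 96 (Haar measure in a chart;
  compact groups unimodular). [Helgason2000]
* G. E. Bredon, *Introduction to Compact Transformation Groups* (1972), Ch. II §5 (finite stabilisers, disjoint
  translates; the tube `K ×_S B`). [Bredon1972]
* E. Hasenpflug, D. Rudolf, B. Sprungk, Ann. Appl. Probab. 34 (2024), App. 4.1 Thm 16 ∕ Remark 17 (the limit
  constant: transversal Hessian determinant and the reference density on the critical manifold); §3.4.
  [HasenpflugRudolfSprungk2024]
* C.-R. Hwang, Ann. Probab. 8 (1980) 1177–1182, main theorem and corollary (the limit of `e^{−nℓ}dμ₀ ∕ Z_n` is carried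
  by the minimum set with density `∝ π₀ · det^{−1/2}`). [Hwang1980]
* K. W. Breitung, LNM 1592 (1994), Thm 41 p. 56, Thm 56 (6.31), §2.3 pp. 14–15. [Breitung1994]
-/

noncomputable section

open _root_.MeasureTheory _root_.MeasureTheory.Measure _root_.Filter _root_.Set _root_.Module _root_.Metric
open scoped _root_.Topology _root_.Real _root_.InnerProductSpace _root_.ENNReal _root_.NNReal _root_.Pointwise

namespace Literature.Analysis.Asymptotics

open Literature.MeasureTheory.Group

/-! ## §1 Averages over shrinking balls at a continuity point -/

section Average

variable {Z : Type*} [MetricSpace Z] [ProperSpace Z] [MeasurableSpace Z]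
  {κ : Measure Z} [IsFiniteMeasureOnCompacts κ] [IsOpenPosMeasure κ]

/-- **Averages over shrinking balls converge at a continuity point**: `g` continuous at `z₀` and integrable on a
ball around it, `κ` finite on compact sets and positive on open sets ⇒ `(∫_{ball z₀ ρ} g dκ) ∕ κ(ball z₀ ρ) → g(z₀)`
as `ρ → 0⁺`. [cite: Breitung1994, §2.3 pp. 14–15 (local behaviour of densities at the critical point)] -/
theorem tendsto_setIntegral_div_measureReal_ball {g : Z → ℝ} {z₀ : Z} (hgc : ContinuousAt g z₀) {ρ₀ : ℝ}
    (hρ₀ : 0 < ρ₀) (hgi : IntegrableOn g (ball z₀ ρ₀) κ) :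
    Tendsto (fun ρ : ℝ => (∫ z in ball z₀ ρ, g z ∂κ) / κ.real (ball z₀ ρ)) (𝓝[>] 0) (𝓝 (g z₀)) := by
  refine Metric.tendsto_nhdsWithin_nhds.2 fun ε hε => ?_
  obtain ⟨δ, hδ, hδg⟩ := Metric.continuousAt_iff.1 hgc (ε / 2) (half_pos hε)
  refine ⟨min δ ρ₀, lt_min hδ hρ₀, fun {ρ} hρ hρd => ?_⟩
  have hρpos : 0 < ρ := hρ
  rw [Real.dist_eq, sub_zero, abs_of_pos hρpos] at hρd
  have hρδ : ρ < δ := lt_of_lt_of_le hρd (min_le_left _ _)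
  have hρρ₀ : ρ < ρ₀ := lt_of_lt_of_le hρd (min_le_right _ _)
  have hlt : κ (ball z₀ ρ) < ∞ :=
    lt_of_le_of_lt (measure_mono ball_subset_closedBall) (isCompact_closedBall z₀ ρ).measure_lt_top
  have hμpos : 0 < κ.real (ball z₀ ρ) := ENNReal.toReal_pos (measure_ball_pos κ z₀ hρpos).ne' hlt.ne
  have hgiρ : IntegrableOn g (ball z₀ ρ) κ := hgi.mono_set (ball_subset_ball hρρ₀.le)
  have h1 : (∫ z in ball z₀ ρ, g z ∂κ) - g z₀ * κ.real (ball z₀ ρ) = ∫ z in ball z₀ ρ, (g z - g z₀) ∂κ := by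
    rw [integral_sub hgiρ (integrableOn_const hlt.ne), setIntegral_const, smul_eq_mul, mul_comm]
  have h2 : ‖∫ z in ball z₀ ρ, (g z - g z₀) ∂κ‖ ≤ ε / 2 * κ.real (ball z₀ ρ) := by
    refine norm_setIntegral_le_of_norm_le_const hlt fun z hz => ?_
    have h := hδg (lt_trans (mem_ball.1 hz) hρδ)
    rw [dist_eq_norm] at h
    exact h.le
  have h3 : (∫ z in ball z₀ ρ, g z ∂κ) / κ.real (ball z₀ ρ) - g z₀ =
      (∫ z in ball z₀ ρ, (g z - g z₀) ∂κ) / κ.real (ball z₀ ρ) := by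
    rw [← h1, sub_div, mul_div_cancel_right₀ _ hμpos.ne']
  rw [Real.dist_eq, h3, abs_div, abs_of_pos hμpos, div_lt_iff₀ hμpos]
  calc |∫ z in ball z₀ ρ, (g z - g z₀) ∂κ| ≤ ε / 2 * κ.real (ball z₀ ρ) := by
        rw [← Real.norm_eq_abs]; exact h2
    _ < ε * κ.real (ball z₀ ρ) := by nlinarith

end Average

/-! ## §2 The group-window constant through a Haar chart: `ν(((e(ball ρ))·S)⁻¹) = |S| · ∫_{ball ρ} h dκ` -/

section WindowConst

variable {K : Type*} [Group K] [TopologicalSpace K] [IsTopologicalGroup K] [T2Space K] [MeasurableSpace K]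
  [BorelSpace K] {ν : Measure K} [IsMulRightInvariant ν] [IsInvInvariant ν]
variable {Z : Type*} [NormedAddCommGroup Z] [NormedSpace ℝ Z] [FiniteDimensional ℝ Z] [MeasurableSpace Z]
  [BorelSpace Z] {κ : Measure Z}
variable {e : Z → K} {U : Set Z} {h : Z → ℝ} {S : Set K}

/-- **The group window through the Haar chart.**  `S ⊆ K` finite, `e : Z → K` continuous with `e 0 = 1`, injective
on an open `U ∋ 0` with the Haar chart identity `ν|_{e(U)} = e_*((h·κ)|_U)` (`h ≥ 0` continuous on `U`), `ν` right-
and inversion-invariant: for all sufficiently small `ρ > 0`,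
`ν(((e(ball 0 ρ))·S)⁻¹) = |S| · ∫_{ball 0 ρ} h dκ` (as real numbers).  The translates `e(ball ρ)·s`, `s ∈ S`, are
pairwise disjoint once `e(ball ρ)` lies in the neighbourhood `P` of `1` of `exists_nhds_one_pairwiseDisjoint_mul_singleton`.
[cite: Bredon1972, Ch. II §5] [cite: Helgason2000, Ch. I §1 Thm 1.14 (13) p. 96 (Haar measure in the chart)] -/
theorem eventually_windowConst_eq_card_mul_setIntegral (he : Continuous e) (he1 : e 0 = 1)
    (hUo : IsOpen U) (h0U : (0 : Z) ∈ U) (hinjU : InjOn e U)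
    (hhc : ContinuousOn h U) (hh0 : ∀ z ∈ U, 0 ≤ h z)
    (hhaar : ν.restrict (e '' U) = ((κ.restrict U).withDensity fun z => ENNReal.ofReal (h z)).map e)
    (hS : S.Finite) :
    ∀ᶠ ρ in 𝓝[>] (0 : ℝ),
      (ν (((e '' ball (0 : Z) ρ) * S)⁻¹)).toReal = S.ncard * ∫ z in ball (0 : Z) ρ, h z ∂κ := by
  classical
  -- disjoint translates of a neighbourhood of `1`
  obtain ⟨P, hP1, -, -, hPdisj⟩ := exists_nhds_one_pairwiseDisjoint_mul_singleton (K := K) hS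
  have hpre : e ⁻¹' P ∈ 𝓝 (0 : Z) := he.continuousAt.preimage_mem_nhds (by rw [he1]; exact hP1)
  obtain ⟨ρ₁, hρ₁, hball₁⟩ := Metric.mem_nhds_iff.1 (inter_mem hpre (hUo.mem_nhds h0U))
  -- a measurable modification of the density
  set h₁ : Z → ℝ := U.piecewise h (fun _ => 0) with hh₁
  have hh₁m : Measurable h₁ := hhc.measurable_piecewise continuousOn_const hUo.measurableSet
  have hh₁U : ∀ z ∈ U, h₁ z = h z := fun z hz => piecewise_eq_of_mem _ _ _ hz
  have hhaar₁ : ν.restrict (e '' U) = ((κ.restrict U).withDensity fun z => ENNReal.ofReal (h₁ z)).map e := by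
    have hae : (fun z => ENNReal.ofReal (h z)) =ᵐ[κ.restrict U] fun z => ENNReal.ofReal (h₁ z) :=
      ae_restrict_of_forall_mem hUo.measurableSet fun z hz => by
        show ENNReal.ofReal (h z) = ENNReal.ofReal (h₁ z)
        rw [hh₁U z hz]
    rw [hhaar, withDensity_congr_ae hae]
  have hev : ∀ᶠ ρ in 𝓝[>] (0 : ℝ), ρ < ρ₁ := nhdsWithin_le_nhds (Iio_mem_nhds hρ₁)
  filter_upwards [hev, self_mem_nhdsWithin] with ρ hρ hρpos
  have hBU : ball (0 : Z) ρ ⊆ U := fun z hz => (hball₁ (ball_subset_ball hρ.le hz)).2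
  have hBP : e '' ball (0 : Z) ρ ⊆ P := by
    rintro _ ⟨z, hz, rfl⟩
    exact (hball₁ (ball_subset_ball hρ.le hz)).1
  have hBm : MeasurableSet (e '' ball (0 : Z) ρ) :=
    measurableSet_ball.image_of_continuousOn_injOn he.continuousOn (hinjU.mono hBU)
  -- counting the translates
  have hdisj' : (↑hS.toFinset : Set K).PairwiseDisjoint fun s => (e '' ball (0 : Z) ρ) * {s} := by
    rw [hS.coe_toFinset]
    exact hPdisj.mono fun s => mul_subset_mul_right hBP
  have hcount := measure_mul_finset_eq_card_mul ν hBm hS.toFinset hdisj'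
  rw [hS.coe_toFinset] at hcount
  -- the chart on the small ball
  have hchartρ : ν.restrict (e '' ball (0 : Z) ρ) =
      ((κ.restrict (ball (0 : Z) ρ)).withDensity fun z => ENNReal.ofReal (h₁ z)).map e :=
    chart_restrict_of_injOn_ofReal he.measurable hinjU hBU hBm hhaar₁
  have hI : ∫ x in e '' ball (0 : Z) ρ, (1 : ℝ) ∂ν = ∫ z in ball (0 : Z) ρ, h₁ z * 1 ∂κ :=
    setIntegral_image_eq_of_chart he.measurable measurableSet_ball hh₁m
      (fun z hz => by rw [hh₁U z (hBU hz)]; exact hh0 z (hBU hz)) hchartρ measurable_const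
  rw [measure_inv, hcount, ENNReal.toReal_mul, ENNReal.toReal_natCast, Set.ncard_eq_toFinset_card _ hS]
  congr 1
  have h1 : (ν (e '' ball (0 : Z) ρ)).toReal = ∫ x in e '' ball (0 : Z) ρ, (1 : ℝ) ∂ν := by
    rw [setIntegral_const, smul_eq_mul, mul_one]
    rfl
  rw [h1, hI]
  exact setIntegral_congr_fun measurableSet_ball fun z hz => by rw [mul_one, hh₁U z (hBU hz)]

/-! ## §3 The orbit constant as `ρ → 0⁺` -/

variable [IsFiniteMeasureOnCompacts κ] [IsOpenPosMeasure κ]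

/-- ★ **The orbit constant tends to `J(0) ∕ (|S| · h(0))`.**  In the setting of
`eventually_windowConst_eq_card_mul_setIntegral` (finite non-empty `S`, Haar chart `(U, h)` for `e` with `h`
continuous at `0`, `h(0) > 0`), for `J₀` continuous at `0` and integrable near `0`:
`(∫_{ball ρ} J₀ dκ) ∕ ν(((e(ball ρ))·S)⁻¹) ⟶ J₀(0) ∕ (|S| · h(0))` as `ρ → 0⁺` (both window integrals are
`κ(ball ρ)` times an average converging to the value at `0`).
[cite: Helgason2000, Ch. I §1 Thm 1.14 (13) p. 96] [cite: Bredon1972, Ch. II §5]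
[cite: HasenpflugRudolfSprungk2024, App. 4.1 Remark 17 (the reference density at the critical manifold)] -/
theorem tendsto_windowConst_ratio (he : Continuous e) (he1 : e 0 = 1)
    (hUo : IsOpen U) (h0U : (0 : Z) ∈ U) (hinjU : InjOn e U)
    (hhc : ContinuousOn h U) (hh0 : ∀ z ∈ U, 0 ≤ h z) (hh00 : 0 < h 0)
    (hhaar : ν.restrict (e '' U) = ((κ.restrict U).withDensity fun z => ENNReal.ofReal (h z)).map e)
    (hS : S.Finite) (hSne : S.Nonempty)
    {J₀ : Z → ℝ} (hJc : ContinuousAt J₀ 0) {ρ₀ : ℝ} (hρ₀ : 0 < ρ₀) (hJi : IntegrableOn J₀ (ball 0 ρ₀) κ) :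
    Tendsto (fun ρ : ℝ => (∫ z in ball (0 : Z) ρ, J₀ z ∂κ) / (ν (((e '' ball (0 : Z) ρ) * S)⁻¹)).toReal)
      (𝓝[>] 0) (𝓝 (J₀ 0 / (S.ncard * h 0))) := by
  have hJ := tendsto_setIntegral_div_measureReal_ball hJc hρ₀ hJi
  -- integrability of `h` near `0`
  obtain ⟨ρ₂, hρ₂, hballU⟩ := Metric.mem_nhds_iff.1 (hUo.mem_nhds h0U)
  have hρ₂' : 0 < ρ₂ / 2 := half_pos hρ₂
  have hcl : closedBall (0 : Z) (ρ₂ / 2) ⊆ U := fun z hz => hballU (closedBall_subset_ball (by linarith) hz)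
  have hhi : IntegrableOn h (ball (0 : Z) (ρ₂ / 2)) κ :=
    (((hhc.mono hcl).integrableOn_compact (isCompact_closedBall _ _))).mono_set ball_subset_closedBall
  have hH := tendsto_setIntegral_div_measureReal_ball (hhc.continuousAt (hUo.mem_nhds h0U)) hρ₂' hhi
  have hev := eventually_windowConst_eq_card_mul_setIntegral (ν := ν) (κ := κ) he he1 hUo h0U hinjU hhc hh0 hhaar hS
  have hn : (0 : ℝ) < S.ncard := Nat.cast_pos.2 ((Set.ncard_pos hS).2 hSne)
  have hlim : Tendsto (fun ρ : ℝ => ((∫ z in ball (0 : Z) ρ, J₀ z ∂κ) / κ.real (ball (0 : Z) ρ)) /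
      (S.ncard * ((∫ z in ball (0 : Z) ρ, h z ∂κ) / κ.real (ball (0 : Z) ρ)))) (𝓝[>] 0)
      (𝓝 (J₀ 0 / (S.ncard * h 0))) :=
    hJ.div (tendsto_const_nhds.mul hH) (mul_pos hn hh00).ne'
  refine hlim.congr' ?_
  filter_upwards [hev, self_mem_nhdsWithin] with ρ hρeq hρpos
  have hρ : 0 < ρ := hρpos
  have hμpos : 0 < κ.real (ball (0 : Z) ρ) :=
    ENNReal.toReal_pos (measure_ball_pos κ 0 hρ).ne'
      (lt_of_le_of_lt (measure_mono ball_subset_closedBall) (isCompact_closedBall (0 : Z) ρ).measure_lt_top).ne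
  rw [hρeq, ← mul_div_assoc, div_div_div_cancel_right₀ hμpos.ne']

end WindowConst

/-! ## §4 The orbit constant does not depend on the window: closed form for every admissible radius -/

section ClosedForm

variable {V : Type*} [NormedAddCommGroup V] [InnerProductSpace ℝ V] [FiniteDimensional ℝ V]
  [MeasurableSpace V] [BorelSpace V]
variable {Z : Type*} [NormedAddCommGroup Z] [NormedSpace ℝ Z] [FiniteDimensional ℝ Z]
  [MeasurableSpace Z] [BorelSpace Z]
variable {K : Type*} [Group K] [TopologicalSpace K] [IsTopologicalGroup K] [CompactSpace K] [T2Space K]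
  [FirstCountableTopology K] [MeasurableSpace K] [BorelSpace K]
variable {X : Type*} [TopologicalSpace X] [CompactSpace X] [T2Space X] [SecondCountableTopology X]
  [MeasurableSpace X] [BorelSpace X]
variable {act : K → X → X} {σ : V → X} {e : Z → K} {Θ : K × V → X} {Θ' : Z × V → X} {S : Set K}
  {ν : Measure K} [ν.IsHaarMeasure] {μ : Measure X} [IsFiniteMeasure μ]
  {κ : Measure Z} [SFinite κ] [IsFiniteMeasureOnCompacts κ] [IsOpenPosMeasure κ]
  {U : Set Z} {h : Z → ℝ}

/-- ★★ **The orbit constant in closed form, for every admissible window.**  In the structural setting of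
`tendsto_laplaceMethod_orbit_indicator_of_continuous` (with the phase `f` and its non-degenerate minimum along `σ`),
plus: `S` finite, and a HAAR CHART for the group chart `e` — `e` injective on an open `U ∋ 0` with
`ν|_{e(U)} = e_*((h·κ)|_U)`, `h ≥ 0` continuous on `U`, `h(0) > 0` — and `κ` positive on open sets:
`(∫_{ball 0 ρ} J(z,0) dκ) ∕ ν(((e(ball 0 ρ))·S)⁻¹) = J(0,0) ∕ (|S| · h(0))` for the consumer's admissible `ρ`.
Proof: the left side is independent of `ρ ∈ (0, ρ]` (two admissible radii give two limits of the same Laplace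
sequence with amplitude `1`; `tendsto_nhds_unique`), and tends to the right side as `ρ → 0⁺` (§3).
[cite: HasenpflugRudolfSprungk2024, App. 4.1 Thm 16 ∕ Remark 17] [cite: Hwang1980, main theorem]
[cite: Helgason2000, Ch. I §1 Thm 1.14 (13) p. 96] [cite: Bredon1972, Ch. II §§4–5] -/
theorem windowConst_ratio_eq_of_continuous
    (hact : Continuous fun p : K × X => act p.1 p.2)
    (hmul : ∀ k k' x, act (k * k') x = act k (act k' x)) (hone : ∀ x, act 1 x = x)
    (hpres : ∀ k, MeasurePreserving (act k) μ μ)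
    (hσ : Continuous σ) (he : Continuous e) (he1 : e 0 = 1) (he𝓝 : 𝓝 (1 : K) ≤ map e (𝓝 0))
    (hΘ : ∀ k y, Θ (k, y) = act k (σ y)) (hΘ' : ∀ z y, Θ' (z, y) = act (e z) (σ y))
    (hΘ'𝓝 : 𝓝 (σ 0) ≤ map Θ' (𝓝 0))
    {W : Set (Z × V)} (hWo : IsOpen W) (hinj : InjOn Θ' W)
    {J : Z × V → ℝ} (hJc : ContinuousOn J W) (hJ0 : ∀ w ∈ W, 0 ≤ J w)
    (hchart : μ.restrict (Θ' '' W) =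
      (((κ.prod volume).restrict W).withDensity fun w => ENNReal.ofReal (J w)).map Θ')
    {ρ : ℝ} (hρ : 0 < ρ) (hρW : closedBall (0 : Z) ρ ×ˢ {(0 : V)} ⊆ W)
    (hstab : ∀ k : K, act k (σ 0) = σ 0 → k ∈ S) (hfix : ∀ s ∈ S, ∀ y, act s (σ y) = σ y)
    {f : X → ℝ} (hf : Continuous f) (hfinv : ∀ k x, f (act k x) = f x)
    {A : V →ₗ[ℝ] V} (hAs : A.IsSymmetric) (hpos : ∀ y, y ≠ 0 → 0 < ⟪A y, y⟫_ℝ)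
    (hS2 : (fun y => f (σ y) - f (σ 0) - (1 / 2) * ⟪A y, y⟫_ℝ) =o[𝓝 0] fun y => ‖y‖ ^ 2)
    (hS : S.Finite) (hUo : IsOpen U) (h0U : (0 : Z) ∈ U) (hinjU : InjOn e U)
    (hhc : ContinuousOn h U) (hh0 : ∀ z ∈ U, 0 ≤ h z) (hh00 : 0 < h 0)
    (hhaar : ν.restrict (e '' U) = ((κ.restrict U).withDensity fun z => ENNReal.ofReal (h z)).map e) :
    (∫ z in ball (0 : Z) ρ, J (z, 0) ∂κ) / (ν (((e '' ball (0 : Z) ρ) * S)⁻¹)).toReal = J 0 / (S.ncard * h 0) := by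
  haveI : IsMulRightInvariant ν := HaarLocalChart.isMulRightInvariant_of_isHaarMeasure ν
  haveI : IsInvInvariant ν := HaarLocalChart.isInvInvariant_of_isHaarMeasure ν
  set C : ℝ → ℝ := fun ρ' =>
    (∫ z in ball (0 : Z) ρ', J (z, 0) ∂κ) / (ν (((e '' ball (0 : Z) ρ') * S)⁻¹)).toReal with hCdef
  -- (1) `C` is constant on the admissible radii `(0, ρ]`
  have hconst : ∀ ρ', 0 < ρ' → ρ' ≤ ρ → C ρ' = C ρ := by
    intro ρ' hρ' hρ'ρ
    have hρ'W : closedBall (0 : Z) ρ' ×ˢ {(0 : V)} ⊆ W :=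
      (Set.prod_mono (closedBall_subset_closedBall hρ'ρ) Subset.rfl).trans hρW
    obtain ⟨r₁, hr₁, h₁⟩ := tendsto_laplaceMethod_orbit_indicator_of_continuous (ν := ν) (κ := κ)
      (φ := fun _ => (1 : ℝ)) hact hmul hone hpres hσ he he1 he𝓝 hΘ hΘ' hΘ'𝓝 hWo hinj hJc hJ0 hchart hρ hρW
      hstab hfix hf continuous_const hfinv (fun _ _ => rfl) hAs hpos hS2
    obtain ⟨r₁', hr₁', h₁'⟩ := tendsto_laplaceMethod_orbit_indicator_of_continuous (ν := ν) (κ := κ)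
      (φ := fun _ => (1 : ℝ)) hact hmul hone hpres hσ he he1 he𝓝 hΘ hΘ' hΘ'𝓝 hWo hinj hJc hJ0 hchart hρ' hρ'W
      hstab hfix hf continuous_const hfinv (fun _ _ => rfl) hAs hpos hS2
    have ha := h₁ (min r₁ r₁') (lt_min hr₁ hr₁') (min_le_left _ _)
    have hb := h₁' (min r₁ r₁') (lt_min hr₁ hr₁') (min_le_right _ _)
    have heq := tendsto_nhds_unique hb ha
    have hπ : (2 * π) ^ ((finrank ℝ V : ℝ) / 2) ≠ 0 := by positivity
    have hνr : ν.real univ ≠ 0 :=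
      (ENNReal.toReal_pos (IsOpenPosMeasure.open_pos univ isOpen_univ univ_nonempty) (measure_ne_top ν _)).ne'
    have hs : Real.sqrt (LinearMap.det A) ≠ 0 := (Real.sqrt_pos.2 (det_pos_of_inner_pos hAs hpos)).ne'
    have h2 := mul_left_cancel₀ hνr (mul_left_cancel₀ hπ heq)
    rw [mul_one, mul_one, div_left_inj' hs] at h2
    exact h2
  -- (2) the small-radius limit of `C`
  have h1S : (1 : K) ∈ S := hstab 1 (hone _)
  have hJcont : ContinuousOn (fun z => J (z, 0)) (closedBall (0 : Z) ρ) :=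
    hJc.comp (continuous_id.prodMk continuous_const).continuousOn fun z hz => hρW ⟨hz, rfl⟩
  have hlim : Tendsto C (𝓝[>] 0) (𝓝 (J 0 / (S.ncard * h 0))) :=
    tendsto_windowConst_ratio (ν := ν) (κ := κ) he he1 hUo h0U hinjU hhc hh0 hh00 hhaar hS ⟨1, h1S⟩
      (J₀ := fun z => J (z, 0)) (hJcont.continuousAt (closedBall_mem_nhds _ hρ)) hρ
      ((hJcont.integrableOn_compact (isCompact_closedBall _ _)).mono_set ball_subset_closedBall)
  -- (3) `C` is eventually the constant `C ρ`; limits are unique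
  have hlim' : Tendsto C (𝓝[>] 0) (𝓝 (C ρ)) := by
    refine tendsto_const_nhds.congr' ?_
    filter_upwards [Ioo_mem_nhdsGT hρ] with ρ' hρ'
    exact (hconst ρ' hρ'.1 hρ'.2.le).symm
  exact tendsto_nhds_unique hlim' hlim

/-! ## §5 The closed-form editions -/

/-- ★★★ **One critical orbit, closed form**: under the hypotheses of `tendsto_laplaceMethod_orbit_indicator_of_continuous`
plus a Haar chart `(U, h)` for `e`, `S` finite, `κ` positive on open sets: there is `r₁ > 0` such that for every
`0 < r ≤ r₁`,
`β^{m/2} ∫_X e^{−β(f − f(σ0))} 1_{Θ(K × ball 0 r)} φ dμ ⟶ (2π)^{m/2} · ν(K) · J(0,0) φ(σ 0) ∕ (|S| · h(0) · √det A)`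
— no window integral left. [cite: HasenpflugRudolfSprungk2024, App. 4.1 Thm 16 ∕ Remark 17]
[cite: Hwang1980, main theorem] [cite: Breitung1994, Thm 41 p. 56] [cite: Helgason2000, Ch. I §1 Thm 1.14 (13) p. 96] -/
theorem tendsto_laplaceMethod_orbit_indicator_closedForm
    (hact : Continuous fun p : K × X => act p.1 p.2)
    (hmul : ∀ k k' x, act (k * k') x = act k (act k' x)) (hone : ∀ x, act 1 x = x)
    (hpres : ∀ k, MeasurePreserving (act k) μ μ)
    (hσ : Continuous σ) (he : Continuous e) (he1 : e 0 = 1) (he𝓝 : 𝓝 (1 : K) ≤ map e (𝓝 0))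
    (hΘ : ∀ k y, Θ (k, y) = act k (σ y)) (hΘ' : ∀ z y, Θ' (z, y) = act (e z) (σ y))
    (hΘ'𝓝 : 𝓝 (σ 0) ≤ map Θ' (𝓝 0))
    {W : Set (Z × V)} (hWo : IsOpen W) (hinj : InjOn Θ' W)
    {J : Z × V → ℝ} (hJc : ContinuousOn J W) (hJ0 : ∀ w ∈ W, 0 ≤ J w)
    (hchart : μ.restrict (Θ' '' W) =
      (((κ.prod volume).restrict W).withDensity fun w => ENNReal.ofReal (J w)).map Θ')
    {ρ : ℝ} (hρ : 0 < ρ) (hρW : closedBall (0 : Z) ρ ×ˢ {(0 : V)} ⊆ W)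
    (hstab : ∀ k : K, act k (σ 0) = σ 0 → k ∈ S) (hfix : ∀ s ∈ S, ∀ y, act s (σ y) = σ y)
    {f φ : X → ℝ} (hf : Continuous f) (hφ : Continuous φ)
    (hfinv : ∀ k x, f (act k x) = f x) (hφinv : ∀ k x, φ (act k x) = φ x)
    {A : V →ₗ[ℝ] V} (hAs : A.IsSymmetric) (hpos : ∀ y, y ≠ 0 → 0 < ⟪A y, y⟫_ℝ)
    (hS2 : (fun y => f (σ y) - f (σ 0) - (1 / 2) * ⟪A y, y⟫_ℝ) =o[𝓝 0] fun y => ‖y‖ ^ 2)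
    (hS : S.Finite) (hUo : IsOpen U) (h0U : (0 : Z) ∈ U) (hinjU : InjOn e U)
    (hhc : ContinuousOn h U) (hh0 : ∀ z ∈ U, 0 ≤ h z) (hh00 : 0 < h 0)
    (hhaar : ν.restrict (e '' U) = ((κ.restrict U).withDensity fun z => ENNReal.ofReal (h z)).map e) :
    ∃ r₁ : ℝ, 0 < r₁ ∧ ∀ r : ℝ, 0 < r → r ≤ r₁ →
      Tendsto (fun β : ℝ => β ^ ((finrank ℝ V : ℝ) / 2) *
          ∫ x, Real.exp (-β * (f x - f (σ 0))) * (Θ '' (univ ×ˢ ball (0 : V) r)).indicator φ x ∂μ) atTop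
        (𝓝 ((2 * π) ^ ((finrank ℝ V : ℝ) / 2) * (ν.real univ *
          (J 0 / (S.ncard * h 0) * φ (σ 0) / Real.sqrt (LinearMap.det A))))) := by
  have hC := windowConst_ratio_eq_of_continuous (ν := ν) (κ := κ) hact hmul hone hpres hσ he he1 he𝓝 hΘ hΘ' hΘ'𝓝
    hWo hinj hJc hJ0 hchart hρ hρW hstab hfix hf hfinv hAs hpos hS2 hS hUo h0U hinjU hhc hh0 hh00 hhaar
  obtain ⟨r₁, hr₁, h₁⟩ := tendsto_laplaceMethod_orbit_indicator_of_continuous (ν := ν) (κ := κ) hact hmul hone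
    hpres hσ he he1 he𝓝 hΘ hΘ' hΘ'𝓝 hWo hinj hJc hJ0 hchart hρ hρW hstab hfix hf hφ hfinv hφinv hAs hpos hS2
  refine ⟨r₁, hr₁, fun r hr hrr₁ => ?_⟩
  have hmain := h₁ r hr hrr₁
  rwa [hC] at hmain

omit [IsOpenPosMeasure κ] in
/-- The one-orbit constants of a finite family of orbits, through a common group chart with Haar chart `(U, h)`:
per orbit `(∫_{ball ρ_i} J_i(z,0)dκ) ∕ ν(((e(ball ρ_i))·S_i)⁻¹) = J_i(0,0) ∕ (|S_i| h(0))` (§4 for each `i`).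
[cite: HasenpflugRudolfSprungk2024, App. 4.1 Thm 16 ∕ Remark 17] [cite: Helgason2000, Ch. I §1 Thm 1.14 (13) p. 96] -/
private theorem windowConst_ratio_eq_family [IsOpenPosMeasure κ] {ι : Type*}
    {σ : ι → V → X} {Θ : ι → K × V → X} {Θ' : ι → Z × V → X} {S : ι → Set K}
    (hact : Continuous fun p : K × X => act p.1 p.2)
    (hmul : ∀ k k' x, act (k * k') x = act k (act k' x)) (hone : ∀ x, act 1 x = x)
    (hpres : ∀ k, MeasurePreserving (act k) μ μ)
    (hσ : ∀ i, Continuous (σ i)) (he : Continuous e) (he1 : e 0 = 1) (he𝓝 : 𝓝 (1 : K) ≤ map e (𝓝 0))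
    (hΘ : ∀ i k y, Θ i (k, y) = act k (σ i y)) (hΘ' : ∀ i z y, Θ' i (z, y) = act (e z) (σ i y))
    (hΘ'𝓝 : ∀ i, 𝓝 (σ i 0) ≤ map (Θ' i) (𝓝 0))
    {W : ι → Set (Z × V)} (hWo : ∀ i, IsOpen (W i)) (hinj : ∀ i, InjOn (Θ' i) (W i))
    {J : ι → Z × V → ℝ} (hJc : ∀ i, ContinuousOn (J i) (W i)) (hJ0 : ∀ i, ∀ w ∈ W i, 0 ≤ J i w)
    (hchart : ∀ i, μ.restrict (Θ' i '' W i) =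
      (((κ.prod volume).restrict (W i)).withDensity fun w => ENNReal.ofReal (J i w)).map (Θ' i))
    {ρ : ι → ℝ} (hρ : ∀ i, 0 < ρ i) (hρW : ∀ i, closedBall (0 : Z) (ρ i) ×ˢ {(0 : V)} ⊆ W i)
    (hstab : ∀ i (k : K), act k (σ i 0) = σ i 0 → k ∈ S i) (hfix : ∀ i, ∀ s ∈ S i, ∀ y, act s (σ i y) = σ i y)
    {f : X → ℝ} (hf : Continuous f) (hfinv : ∀ k x, f (act k x) = f x)
    {A : ι → V →ₗ[ℝ] V} (hAs : ∀ i, (A i).IsSymmetric) (hpos : ∀ i y, y ≠ 0 → 0 < ⟪A i y, y⟫_ℝ)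
    (hS2 : ∀ i, (fun y => f (σ i y) - f (σ i 0) - (1 / 2) * ⟪A i y, y⟫_ℝ) =o[𝓝 0] fun y => ‖y‖ ^ 2)
    (hS : ∀ i, (S i).Finite) (hUo : IsOpen U) (h0U : (0 : Z) ∈ U) (hinjU : InjOn e U)
    (hhc : ContinuousOn h U) (hh0 : ∀ z ∈ U, 0 ≤ h z) (hh00 : 0 < h 0)
    (hhaar : ν.restrict (e '' U) = ((κ.restrict U).withDensity fun z => ENNReal.ofReal (h z)).map e) (i : ι) :
    (∫ z in ball (0 : Z) (ρ i), J i (z, 0) ∂κ) / (ν (((e '' ball (0 : Z) (ρ i)) * S i)⁻¹)).toReal =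
      J i 0 / ((S i).ncard * h 0) :=
  windowConst_ratio_eq_of_continuous (ν := ν) (κ := κ) hact hmul hone hpres (hσ i) he he1 he𝓝 (hΘ i) (hΘ' i)
    (hΘ'𝓝 i) (hWo i) (hinj i) (hJc i) (hJ0 i) (hchart i) (hρ i) (hρW i) (hstab i) (hfix i) hf hfinv (hAs i)
    (hpos i) (hS2 i) (hS i) hUo h0U hinjU hhc hh0 hh00 hhaar

/-- ★★★ **Finitely many critical orbits, closed form**: under the hypotheses of
`tendsto_laplaceMethod_sum_orbits_of_continuous` plus a Haar chart `(U, h)` for the common group chart `e`, all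
`S_i` finite and `κ` positive on open sets,
`β^{m/2} ∫_X e^{−β(f − f₀)} φ dμ ⟶ Σ_i (2π)^{m/2} ν(K) J_i(0,0) φ(σ_i 0) ∕ (|S_i| h(0) √det A_i)`.
[cite: HasenpflugRudolfSprungk2024, §3.4 and App. 4.1 Thm 16 ∕ Remark 17] [cite: Breitung1994, Thm 56 (6.31)]
[cite: Hwang1980, main theorem] [cite: Helgason2000, Ch. I §1 Thm 1.14 (13) p. 96] -/
theorem tendsto_laplaceMethod_sum_orbits_closedForm {ι : Type*} [Fintype ι]
    {σ : ι → V → X} {Θ : ι → K × V → X} {Θ' : ι → Z × V → X} {S : ι → Set K}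
    (hact : Continuous fun p : K × X => act p.1 p.2)
    (hmul : ∀ k k' x, act (k * k') x = act k (act k' x)) (hone : ∀ x, act 1 x = x)
    (hpres : ∀ k, MeasurePreserving (act k) μ μ)
    (hσ : ∀ i, Continuous (σ i)) (he : Continuous e) (he1 : e 0 = 1) (he𝓝 : 𝓝 (1 : K) ≤ map e (𝓝 0))
    (hΘ : ∀ i k y, Θ i (k, y) = act k (σ i y)) (hΘ' : ∀ i z y, Θ' i (z, y) = act (e z) (σ i y))
    (hΘ'𝓝 : ∀ i, 𝓝 (σ i 0) ≤ map (Θ' i) (𝓝 0))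
    {W : ι → Set (Z × V)} (hWo : ∀ i, IsOpen (W i)) (hinj : ∀ i, InjOn (Θ' i) (W i))
    {J : ι → Z × V → ℝ} (hJc : ∀ i, ContinuousOn (J i) (W i)) (hJ0 : ∀ i, ∀ w ∈ W i, 0 ≤ J i w)
    (hchart : ∀ i, μ.restrict (Θ' i '' W i) =
      (((κ.prod volume).restrict (W i)).withDensity fun w => ENNReal.ofReal (J i w)).map (Θ' i))
    {ρ : ι → ℝ} (hρ : ∀ i, 0 < ρ i) (hρW : ∀ i, closedBall (0 : Z) (ρ i) ×ˢ {(0 : V)} ⊆ W i)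
    (hstab : ∀ i (k : K), act k (σ i 0) = σ i 0 → k ∈ S i) (hfix : ∀ i, ∀ s ∈ S i, ∀ y, act s (σ i y) = σ i y)
    {f φ : X → ℝ} (hf : Continuous f) (hφ : Continuous φ)
    (hfinv : ∀ k x, f (act k x) = f x) (hφinv : ∀ k x, φ (act k x) = φ x)
    {A : ι → V →ₗ[ℝ] V} (hAs : ∀ i, (A i).IsSymmetric) (hpos : ∀ i y, y ≠ 0 → 0 < ⟪A i y, y⟫_ℝ)
    (hS2 : ∀ i, (fun y => f (σ i y) - f (σ i 0) - (1 / 2) * ⟪A i y, y⟫_ℝ) =o[𝓝 0] fun y => ‖y‖ ^ 2)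
    {f₀ : ℝ} (hf₀ : ∀ i, f (σ i 0) = f₀) (hglob : ∀ x, f₀ ≤ f x)
    (hzero : ∀ x, f x = f₀ → ∃ i k, act k (σ i 0) = x)
    (hdist : ∀ i j, i ≠ j → ∀ k : K, act k (σ i 0) ≠ σ j 0)
    (hS : ∀ i, (S i).Finite) (hUo : IsOpen U) (h0U : (0 : Z) ∈ U) (hinjU : InjOn e U)
    (hhc : ContinuousOn h U) (hh0 : ∀ z ∈ U, 0 ≤ h z) (hh00 : 0 < h 0)
    (hhaar : ν.restrict (e '' U) = ((κ.restrict U).withDensity fun z => ENNReal.ofReal (h z)).map e) :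
    Tendsto (fun β : ℝ => β ^ ((finrank ℝ V : ℝ) / 2) * ∫ x, Real.exp (-β * (f x - f₀)) * φ x ∂μ) atTop
      (𝓝 (∑ i, (2 * π) ^ ((finrank ℝ V : ℝ) / 2) * (ν.real univ *
          (J i 0 / ((S i).ncard * h 0) * φ (σ i 0) / Real.sqrt (LinearMap.det (A i)))))) := by
  have hC := windowConst_ratio_eq_family (ν := ν) (μ := μ) (κ := κ) hact hmul hone hpres hσ he he1 he𝓝 hΘ hΘ'
    hΘ'𝓝 hWo hinj hJc hJ0 hchart hρ hρW hstab hfix hf hfinv hAs hpos hS2 hS hUo h0U hinjU hhc hh0 hh00 hhaar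
  have hmain := tendsto_laplaceMethod_sum_orbits_of_continuous (ν := ν) (κ := κ) hact hmul hone hpres hσ he he1
    he𝓝 hΘ hΘ' hΘ'𝓝 hWo hinj hJc hJ0 hchart hρ hρW hstab hfix hf hφ hfinv hφinv hAs hpos hS2 hf₀ hglob hzero hdist
  simp only [hC] at hmain
  exact hmain

/-- ★★★ **The `β → ∞` state: finitely many vacua with explicit weights.**  Under the hypotheses of
`tendsto_gibbs_expectation_sum_orbits_of_continuous` plus a Haar chart `(U, h)` for the common group chart `e` and
all `S_i` finite, the normalised Laplace means converge to the average of `φ` over the vacua `σ_i(0)` with the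
WEIGHTS `w_i = J_i(0,0) ∕ (|S_i| · √det A_i)` (chart density at the vacuum ∕ stabiliser order ∕ Gaussian determinant of
the transversal Hessian): `∫ e^{−βf} φ dμ ∕ ∫ e^{−βf} dμ ⟶ (Σ_i w_i φ(σ_i 0)) ∕ Σ_i w_i`.
[cite: Hwang1980, main theorem and corollary (limit of `e^{−nℓ}dμ₀ ∕ Z_n`: density `∝ π₀ · det^{−1/2}` on the minimum set)]
[cite: HasenpflugRudolfSprungk2024, §3.4 and App. 4.1 Remark 17] [cite: Breitung1994, Thm 56 (6.31)]
[cite: Helgason2000, Ch. I §1 Thm 1.14 (13) p. 96] -/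
theorem tendsto_gibbs_expectation_sum_orbits_closedForm {ι : Type*} [Fintype ι] [Nonempty ι]
    {σ : ι → V → X} {Θ : ι → K × V → X} {Θ' : ι → Z × V → X} {S : ι → Set K}
    (hact : Continuous fun p : K × X => act p.1 p.2)
    (hmul : ∀ k k' x, act (k * k') x = act k (act k' x)) (hone : ∀ x, act 1 x = x)
    (hpres : ∀ k, MeasurePreserving (act k) μ μ)
    (hσ : ∀ i, Continuous (σ i)) (he : Continuous e) (he1 : e 0 = 1) (he𝓝 : 𝓝 (1 : K) ≤ map e (𝓝 0))
    (hΘ : ∀ i k y, Θ i (k, y) = act k (σ i y)) (hΘ' : ∀ i z y, Θ' i (z, y) = act (e z) (σ i y))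
    (hΘ'𝓝 : ∀ i, 𝓝 (σ i 0) ≤ map (Θ' i) (𝓝 0))
    {W : ι → Set (Z × V)} (hWo : ∀ i, IsOpen (W i)) (hinj : ∀ i, InjOn (Θ' i) (W i))
    {J : ι → Z × V → ℝ} (hJc : ∀ i, ContinuousOn (J i) (W i)) (hJ0 : ∀ i, ∀ w ∈ W i, 0 ≤ J i w)
    (hJ00 : ∀ i, 0 < J i 0)
    (hchart : ∀ i, μ.restrict (Θ' i '' W i) =
      (((κ.prod volume).restrict (W i)).withDensity fun w => ENNReal.ofReal (J i w)).map (Θ' i))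
    {ρ : ι → ℝ} (hρ : ∀ i, 0 < ρ i) (hρW : ∀ i, closedBall (0 : Z) (ρ i) ×ˢ {(0 : V)} ⊆ W i)
    (hstab : ∀ i (k : K), act k (σ i 0) = σ i 0 → k ∈ S i) (hfix : ∀ i, ∀ s ∈ S i, ∀ y, act s (σ i y) = σ i y)
    {f φ : X → ℝ} (hf : Continuous f) (hφ : Continuous φ)
    (hfinv : ∀ k x, f (act k x) = f x) (hφinv : ∀ k x, φ (act k x) = φ x)
    {A : ι → V →ₗ[ℝ] V} (hAs : ∀ i, (A i).IsSymmetric) (hpos : ∀ i y, y ≠ 0 → 0 < ⟪A i y, y⟫_ℝ)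
    (hS2 : ∀ i, (fun y => f (σ i y) - f (σ i 0) - (1 / 2) * ⟪A i y, y⟫_ℝ) =o[𝓝 0] fun y => ‖y‖ ^ 2)
    {f₀ : ℝ} (hf₀ : ∀ i, f (σ i 0) = f₀) (hglob : ∀ x, f₀ ≤ f x)
    (hzero : ∀ x, f x = f₀ → ∃ i k, act k (σ i 0) = x)
    (hdist : ∀ i j, i ≠ j → ∀ k : K, act k (σ i 0) ≠ σ j 0)
    (hS : ∀ i, (S i).Finite) (hUo : IsOpen U) (h0U : (0 : Z) ∈ U) (hinjU : InjOn e U)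
    (hhc : ContinuousOn h U) (hh0 : ∀ z ∈ U, 0 ≤ h z) (hh00 : 0 < h 0)
    (hhaar : ν.restrict (e '' U) = ((κ.restrict U).withDensity fun z => ENNReal.ofReal (h z)).map e) :
    Tendsto (fun β : ℝ => (∫ x, Real.exp (-β * f x) * φ x ∂μ) / ∫ x, Real.exp (-β * f x) ∂μ) atTop
      (𝓝 ((∑ i, J i 0 / ((S i).ncard * Real.sqrt (LinearMap.det (A i))) * φ (σ i 0)) /
        ∑ i, J i 0 / ((S i).ncard * Real.sqrt (LinearMap.det (A i))))) := by
  have hC := windowConst_ratio_eq_family (ν := ν) (μ := μ) (κ := κ) hact hmul hone hpres hσ he he1 he𝓝 hΘ hΘ'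
    hΘ'𝓝 hWo hinj hJc hJ0 hchart hρ hρW hstab hfix hf hfinv hAs hpos hS2 hS hUo h0U hinjU hhc hh0 hh00 hhaar
  have hmain := tendsto_gibbs_expectation_sum_orbits_of_continuous (ν := ν) (κ := κ) hact hmul hone hpres hσ he
    he1 he𝓝 hΘ hΘ' hΘ'𝓝 hWo hinj hJc hJ0 hJ00 hchart hρ hρW hstab hfix hf hφ hfinv hφinv hAs hpos hS2 hf₀ hglob
    hzero hdist
  simp only [hC] at hmain
  -- cancel the common factor `(2π)^{m/2} ν(K) ∕ h(0)`
  have h1S : ∀ i, (S i).Nonempty := fun i => ⟨1, hstab i 1 (hone _)⟩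
  have hn : ∀ i, (0 : ℝ) < (S i).ncard := fun i => Nat.cast_pos.2 ((Set.ncard_pos (hS i)).2 (h1S i))
  have hs : ∀ i, 0 < Real.sqrt (LinearMap.det (A i)) := fun i =>
    Real.sqrt_pos.2 (det_pos_of_inner_pos (hAs i) (hpos i))
  set P : ℝ := (2 * π) ^ ((finrank ℝ V : ℝ) / 2) * ν.real univ / h 0 with hP
  have hterm : ∀ (i : ι) (t : ℝ), (2 * π) ^ ((finrank ℝ V : ℝ) / 2) * (ν.real univ *
      (J i 0 / ((S i).ncard * h 0) * t / Real.sqrt (LinearMap.det (A i)))) =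
      P * (J i 0 / ((S i).ncard * Real.sqrt (LinearMap.det (A i))) * t) := by
    intro i t
    simp only [hP]
    field_simp
  have hnum : (∑ i, (2 * π) ^ ((finrank ℝ V : ℝ) / 2) * (ν.real univ *
      (J i 0 / ((S i).ncard * h 0) * φ (σ i 0) / Real.sqrt (LinearMap.det (A i))))) =
      P * ∑ i, J i 0 / ((S i).ncard * Real.sqrt (LinearMap.det (A i))) * φ (σ i 0) := by
    rw [Finset.mul_sum]
    exact Finset.sum_congr rfl fun i _ => hterm i (φ (σ i 0))
  have hden : (∑ i, (2 * π) ^ ((finrank ℝ V : ℝ) / 2) * (ν.real univ *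
      (J i 0 / ((S i).ncard * h 0) / Real.sqrt (LinearMap.det (A i))))) =
      P * ∑ i, J i 0 / ((S i).ncard * Real.sqrt (LinearMap.det (A i))) := by
    rw [Finset.mul_sum]
    refine Finset.sum_congr rfl fun i _ => ?_
    have h1 := hterm i 1
    rw [mul_one, mul_one] at h1
    exact h1
  have hPne : P ≠ 0 := by
    have hνr : 0 < ν.real univ :=
      ENNReal.toReal_pos (IsOpenPosMeasure.open_pos univ isOpen_univ univ_nonempty) (measure_ne_top ν _)
    simp only [hP]
    positivity
  rw [hnum, hden, mul_div_mul_left _ _ hPne] at hmain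
  exact hmain

end ClosedForm

end Literature.Analysis.Asymptotics
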